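import Summits.QuantumFields.BalabanUV.T4Continuum.Support.SubstrateVocabularyV3

/-!
# SUBSTRATE — VOCABULARY V1 ↔ V3, part 1c (descent): a PERIODIC configuration on `ℤ^d` is determined by its values on one period box
# and DESCENDS to a gauge field of record on the torus; lift ∘ descent = id on periodic configurations with values in the image of
# `ι`, descent ∘ lift = id

Cell `pub-balaban`, SUBSTRATE cell, seat `b2b-balaban-substrate-p2`; registry item S-VOC-2 (MAP v0.3 §4 p2 (3), [dict] line D-3), part 1c —
independent of the averaging question (journal finding F-SUB-p2-1).  Follower of `SubstrateVocabularyV3` (p219008: `toZMod`, `liftCfg`)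
BY NAME; row NE3's `IsPeriodicCfg` (`T4AveragingDeficitWallBoundary`) is the periodicity predicate; edits nothing.

HONEST FRAMING (T4-DAG p. 1).  Rung (B)+1 of the FINITE-VOLUME T⁴ continuum programme — NOT infinite volume, NOT a mass gap, NOT the
Clay problem, NOT summit progress, no estimate; a DICTIONARY (identities only).  HONEST DEPENDENCY (cell line, verbatim): continuum YM
on T⁴ ⇐ BetaPertH ∧ nine spine estimates (0/9 proved); BetaPertH ⇐ (D1) ∧ (D4) ∧ CAP+tail; G-an2-4 gates asym, D1 and NE2/3/4.

WHAT THIS FILE PROVES.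
* §1 `reprSite y` — the canonical integer label in the period box `{0,…,N_j−1}^d` of a torus site (`toZMod_reprSite`, `reprSite_mem_box`);
  **periodic reduction**: an `N`-periodic configuration (`IsPeriodicCfg V N`, any `N : ℤ`) is invariant under all translations of the period
  lattice (`apply_add_zsmul_period`, `apply_add_sum_period`), hence for `N = N_j` it is READ OFF ITS PERIOD BOX:
  **`apply_eq_apply_reprSite : V x μ = V (reprSite (toZMod j x)) μ`**, and `V x = V x'` whenever `toZMod j x = toZMod j x'`.
* §2 **`descendCfg κ V : GaugeField P j G`** (`κ : H → G` a retraction of the values, e.g. the inverse of `Unitary.toUnits` on unitary units):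
  `descendCfg κ V ⟨y, μ⟩ = κ (V (reprSite y) μ)`; **`descendCfg_liftCfg`** (`κ ∘ ι = id` ⇒ descent ∘ lift = id) and **`liftCfg_descendCfg`**
  (`V` `N_j`-periodic with `ι (κ (V x μ)) = V x μ` ⇒ lift ∘ descent = `V`): periodic V3 configurations with values in the image of `ι`
  ARE the level-`j` gauge fields of record.
No estimate, no `def … : Prop`, no `sorry`.
-/

noncomputable section

open scoped BigOperators

namespace Summit.QuantumFields.BalabanUV.T4Continuum.SubstrateVocabularyV3

open Literature.MathematicalPhysics.QuantumFieldTheory.Balaban1983to89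
open Literature.MathematicalPhysics.QuantumFieldTheory.Balaban1983to89.B7Prop1Explicit (e e_apply)
open Literature.MathematicalPhysics.QuantumFieldTheory.Balaban1983to89.T4AveragingDeficitWallBoundary (IsPeriodicCfg)

variable {P : Params} {j : ℕ}

/-! ## §1 Canonical representatives and periodic reduction -/

/-- [folklore] THE CANONICAL INTEGER LABEL of a torus site: coordinatewise `ZMod.val`, in the period box `{0,…,N_j−1}^d`. -/
def reprSite (y : Site P j) : B7Prop1Explicit.Site P.d := fun μ => ((y μ).val : ℤ)

/-- [folklore] `reprSite` coordinatewise. -/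
@[simp] theorem reprSite_apply (y : Site P j) (μ : Fin P.d) : reprSite y μ = ((y μ).val : ℤ) := rfl

/-- [folklore] The canonical label reduces back to the site. -/
@[simp] theorem toZMod_reprSite (y : Site P j) : toZMod j (reprSite y) = y := by
  funext μ
  simp [reprSite]

/-- [folklore] The canonical label lies in the period box: `0 ≤ reprSite y μ < N_j`. -/
theorem reprSite_mem_box (y : Site P j) (μ : Fin P.d) : 0 ≤ reprSite y μ ∧ reprSite y μ < (P.sitesPerDir j : ℤ) := by
  rw [reprSite_apply]
  exact ⟨Int.natCast_nonneg _, by exact_mod_cast ZMod.val_lt (y μ)⟩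

/-- [folklore] The canonical label of `toZMod j x` is the coordinatewise remainder of `x` modulo `N_j`. -/
theorem reprSite_toZMod (x : B7Prop1Explicit.Site P.d) (μ : Fin P.d) :
    reprSite (toZMod (P := P) j x) μ = x μ % (P.sitesPerDir j : ℤ) := by
  rw [reprSite_apply, toZMod_apply, ZMod.val_intCast]

section Periodic

variable {n : Type*} [Fintype n] [DecidableEq n] {V : B7Prop1Explicit.Site P.d → Fin P.d → (Matrix n n ℂ)ˣ} {N : ℤ}

/-- [folklore] **PERIODIC REDUCTION, one direction, all multiples**: an `N`-periodic configuration is invariant under `x ↦ x + (mN)e_κ`, `m ∈ ℤ`. -/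
theorem apply_add_zsmul_period (hV : IsPeriodicCfg V N) (κ μ : Fin P.d) :
    ∀ (m : ℤ) (x : B7Prop1Explicit.Site P.d), V (x + (m * N) • e κ) μ = V x μ := by
  intro m
  induction m using Int.induction_on with
  | zero => intro x; simp
  | succ m ih =>
    intro x
    have h1 : x + ((↑m + 1) * N) • e κ = (x + (↑m * N) • e κ) + N • e κ := by rw [add_mul, one_mul, add_smul, add_assoc]
    rw [h1, hV, ih]
  | pred m ih =>
    intro x
    have h1 : x + ((-(m : ℤ) - 1) * N) • e κ + N • e κ = x + ((-(m : ℤ)) * N) • e κ := by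
      rw [add_assoc, ← add_smul]; congr 2; ring
    rw [← hV (x + ((-(m : ℤ) - 1) * N) • e κ) κ μ, h1, ih]

/-- [folklore] **PERIODIC REDUCTION, all directions**: invariance under every translation of the period lattice `Σ_κ (m_κ N) e_κ`. -/
theorem apply_add_sum_period (hV : IsPeriodicCfg V N) (x : B7Prop1Explicit.Site P.d) (m : Fin P.d → ℤ) (μ : Fin P.d) :
    V (x + ∑ κ, (m κ * N) • e κ) μ = V x μ := by
  classical
  suffices h : ∀ s : Finset (Fin P.d), V (x + ∑ κ ∈ s, (m κ * N) • e κ) μ = V x μ from h Finset.univ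
  intro s
  induction s using Finset.induction_on with
  | empty => simp
  | insert a s ha ih => rw [Finset.sum_insert ha, add_comm ((m a * N) • e a), ← add_assoc, apply_add_zsmul_period hV, ih]

/-- [folklore] An integer label is its canonical representative plus a period-lattice vector (coordinatewise `x = x % N + (x / N)·N`). -/
theorem eq_reprSite_add_sum (x : B7Prop1Explicit.Site P.d) :
    x = reprSite (toZMod (P := P) j x) + ∑ κ, ((x κ / (P.sitesPerDir j : ℤ)) * (P.sitesPerDir j : ℤ)) • e κ := by
  funext ν
  rw [Pi.add_apply, reprSite_toZMod, Finset.sum_apply]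
  simp only [Pi.smul_apply, e_apply, smul_eq_mul, mul_ite, mul_one, mul_zero, Finset.sum_ite_eq, Finset.mem_univ, if_true]
  exact (Int.emod_add_ediv_mul (x ν) _).symm

/-- [folklore] **AN `N_j`-PERIODIC CONFIGURATION IS READ OFF ITS PERIOD BOX**: `V x μ = V (reprSite (toZMod j x)) μ`. -/
theorem apply_eq_apply_reprSite (hV : IsPeriodicCfg V (P.sitesPerDir j : ℤ)) (x : B7Prop1Explicit.Site P.d) (μ : Fin P.d) :
    V x μ = V (reprSite (toZMod (P := P) j x)) μ := by
  have hx := eq_reprSite_add_sum (P := P) (j := j) x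
  have h := apply_add_sum_period hV (reprSite (toZMod (P := P) j x)) (fun κ => x κ / (P.sitesPerDir j : ℤ)) μ
  rw [← hx] at h
  exact h

/-- [folklore] Hence an `N_j`-periodic configuration depends on the label only through its torus site. -/
theorem apply_eq_of_toZMod_eq (hV : IsPeriodicCfg V (P.sitesPerDir j : ℤ)) {x x' : B7Prop1Explicit.Site P.d}
    (h : toZMod (P := P) j x = toZMod j x') : V x = V x' := by
  funext μ
  rw [apply_eq_apply_reprSite hV x, apply_eq_apply_reprSite hV x', h]

end Periodic

/-! ## §2 Descent of periodic configurations to gauge fields of record -/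

section Descent

variable {G : Type*} {H : Type*}

/-- [folklore] **DESCENT**: a configuration on `ℤ^d` read on the canonical labels of the torus bonds, through a retraction `κ : H → G` of
the values (for `U(n)`: the inverse of `Unitary.toUnits` on the unitary units). -/
def descendCfg (κ : H → G) (V : B7Prop1Explicit.Site P.d → Fin P.d → H) : GaugeField P j G :=
  fun b => κ (V (reprSite b.src) b.dir)

/-- [folklore] `descendCfg` unfolded. -/
@[simp] theorem descendCfg_apply (κ : H → G) (V : B7Prop1Explicit.Site P.d → Fin P.d → H) (b : PBond P j) :
    descendCfg κ V b = κ (V (reprSite b.src) b.dir) := rfl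

variable [GaugeGroup G] [Group H] in
/-- [folklore] **DESCENT ∘ LIFT = id** for a retraction `κ` of `ι` (`κ (ι g) = g`). -/
theorem descendCfg_liftCfg (ι : G →* H) (κ : H → G) (hκι : ∀ g, κ (ι g) = g) (U : GaugeField P j G) :
    descendCfg κ (liftCfg ι U) = U := by
  funext b
  rw [descendCfg_apply, liftCfg_apply, toZMod_reprSite, hκι]

end Descent

section DescentPeriodic

variable {G : Type*} [GaugeGroup G] {n : Type*} [Fintype n] [DecidableEq n]

/-- [folklore] **LIFT ∘ DESCENT = id ON PERIODIC CONFIGURATIONS WITH VALUES IN THE IMAGE OF `ι`**: for `V` `N_j`-periodic and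
`ι (κ (V x μ)) = V x μ` everywhere, `liftCfg ι (descendCfg κ V) = V` — periodic V3 configurations ARE the gauge fields of record. -/
theorem liftCfg_descendCfg (ι : G →* (Matrix n n ℂ)ˣ) (κ : (Matrix n n ℂ)ˣ → G)
    {V : B7Prop1Explicit.Site P.d → Fin P.d → (Matrix n n ℂ)ˣ} (hV : IsPeriodicCfg V (P.sitesPerDir j : ℤ))
    (hικ : ∀ x μ, ι (κ (V x μ)) = V x μ) : liftCfg ι (descendCfg (j := j) κ V) = V := by
  funext x μ
  rw [liftCfg_apply, descendCfg_apply, hικ, ← apply_eq_apply_reprSite hV]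

end DescentPeriodic

end Summit.QuantumFields.BalabanUV.T4Continuum.SubstrateVocabularyV3

end
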